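import Summits.QuantumFields.BalabanUV.Beta.GAN24.KernelLegCharges
import Summits.QuantumFields.BalabanUV.Beta.GAN24.MultiplierZeroMass

/-!
# `BalabanUV.Beta.GAN24.ResolventLegCharges` — row G-an2-4 ∕ (CONV-C), W-slot, SKELETON-W3 §7.2 sum rule (S3c), PART 2a:
# THE FOUR COARSE-LEG CHARGES OF THE PACKED RESOLVENT AND THE SANDWICH READ-OUT FUBINI `Σ'_{x′z′} (K∘V∘K)(N•x′, N•z′)_{mm} = Σ' ρL·V·ρR`

NOT IN PRINT; OUR PROOF ATTEMPT (idle-seat one-shot kernel lemma under the row owner's RULINGS-13 invitation «W3-S3C*», unit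
`b2b-balaban-gan24-formalise-leaf-06`, gen 8; RULINGS-14 «continue to `e3Of m`»).  HONEST FRAMING (cell contract, verbatim): «discharging `BetaPertH`
makes Bałaban's UV stability UNCONDITIONAL — a real constructive-QFT result; it is NOT the continuum limit and NOT the Clay problem.»  HONEST
DEPENDENCY (verbatim): «continuum YM on T⁴ ⇐ BetaPertH ∧ nine spine estimates (0/9 proved); BetaPertH ⇐ (D1) ∧ (D4) ∧ CAP+tail; G-an2-4 gates asym,
D1 and NE2/3/4.»

WHAT ([folklore] Fubini over absolutely convergent lattice sums; generic `d`, generic blocking `N ≥ 1`; 0 `def`, 0 cite, 0 sorry):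
* §1 a UNIFORM bound for coarse exponential sums `Σ'_{x′} e^{−δ|N•x′ − y|₁} ≤ e^{δN(d+1)}·Zl(δ)` (`tsum_exp_coarse_le`; `eq_repZ_add_zsmul_quo`);
* §2 THE FOUR COARSE-LEG CHARGES of an2's packed resolvent `OneStepResolventKernel.KInv N`, as `HasSum` families over the coarse index and
  SITE-FREE: multiplier–field ROW `−δ·N^{−(d+2)}` (PART 1a `KernelLegCharges.hasSum_KInv_inr_inl`, (Q-lin)), field–multiplier COLUMN
  `+δ·N^{−(d+2)}` (`hasSum_KInv_inl_inr`, `lowMomentsSum_specK`), and the two multiplier–multiplier legs ZERO (`hasSum_KInv_inr_inr_left/right`: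
  (S2c) = leaf-14's `MultiplierZeroMass.hasSum_wΦ_sub_left/right` BY NAME); packaged on the fibre as `hasSum_KInv_row` ∕ `hasSum_KInv_col`;
* §3 **THE SANDWICH READ-OUT FUBINI** (`hasSum_sandwich_readout`): for a decaying `K` whose coarse-leg row∕column charges against `(inr α)`∕`(inr β)`
  are site-free (`ρL f`, `ρR g`) and ANY bi-localised `V`, the `mm`-read of `K ∘ V ∘ K` has the double-leg `HasSum`
  `Σ'_{(y,w)} Σ_{f,g} ρL f · V y w f g · ρR g`; instance `hasSum_sandwich_readout_KInv`: for `K = KInv N` the value is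
  `−N^{−2(d+2)} · Σ'_{(y,w)} V y w (inl α) (inl β)` — ONLY the field–field double-leg sum of `V` survives.
Consumed by PART 2b `GAN24/ValueJetChargeZero` (`e3OfS`∕`e3Of m` on two constant field legs = 0).  A generic twin, in the iterated-`tsum` ∕ site-dependent
charge currency, is leaf-02's `GAN24/BiStencilZeroMode` (disjoint statements; both [folklore]).  Asserts NO shape of Bałaban's tables, pins no colour
constant, discharges NOTHING of «T2Shape»∕(hW, hWall).  NOT «W-slot closed», NEVER «G-an2-4 closed»; NOT BetaPertH, NOT continuum, NOT Clay.
-/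

noncomputable section

open Finset
open scoped BigOperators
open Literature.Probability.LatticeModels (Torus.proj)
open Literature.MathematicalPhysics.QuantumFieldTheory
open Literature.MathematicalPhysics.QuantumFieldTheory.Balaban1983to89
open Literature.MathematicalPhysics.QuantumFieldTheory.Balaban1983to89.Beta
open B12Sec2to5 (l1 l1_nonneg Decay510 summable_exp_neg_l1)
open ExpKernelCalculus (Site MKer BiLoc Decays comp shiftK l1_natSmul l1_sub_triangle l1_sub_symm Zl Zl_nonneg summable_exp_shift
  summable_exp_shift' tsum_exp_shift tsum_exp_shift')
open LatticeForm (repZ quo)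
open BlochFibreMatrix (eq_repZ_add_zsmul_quo)
open KKTFluctuationKernel (l1_repZ_le)
open KernelSpecInstance (wH wΦ lowMomentsSum_specK)
open KernelRepresentationSummable (constReproSum_iff_decimated)
open OneStepResolventKernel (Fib KInv KInv_inl_inr_coarse KInv_inr_inl_coarse proj_zsmul quo_zsmul decays_KInv)
open Summit.QuantumFields.BalabanUV.Beta.GAN24.KernelLegCharges (summable_exp_coarse hasSum_KInv_inr_inl)
open Summit.QuantumFields.BalabanUV.Beta.GAN24.MultiplierZeroMass (hasSum_wΦ_sub_left hasSum_wΦ_sub_right)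

namespace Summit.QuantumFields.BalabanUV.Beta.GAN24.ResolventLegCharges

variable {d : ℕ}

/-! ## §1 Uniform coarse exponential sums -/

/-- [folklore] `e^{−δ|N•x′ − y|₁} ≤ e^{δN(d+1)} · e^{−δ|x′ − quo_N y|₁}` (`y = repZ + N•quo y`, `|repZ|₁ ≤ N(d+1)`, `N ≥ 1`). -/
theorem exp_coarse_le (N : ℕ) [NeZero N] {δ : ℝ} (hδ : 0 ≤ δ) (x' y : Site (d + 1)) :
    Real.exp (-δ * l1 ((N : ℤ) • x' - y)) ≤ Real.exp (δ * ((N : ℝ) * (d + 1))) * Real.exp (-δ * l1 (x' - quo N y)) := by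
  rw [← Real.exp_add, Real.exp_le_exp]
  have hN : (1 : ℝ) ≤ N := by exact_mod_cast Nat.one_le_iff_ne_zero.2 (NeZero.ne N)
  have h1 : l1 ((N : ℤ) • (x' - quo N y)) ≤ l1 ((N : ℤ) • x' - y) + l1 (y - (N : ℤ) • quo N y) := by
    have := l1_sub_triangle ((N : ℤ) • x') y ((N : ℤ) • quo N y)
    rwa [← smul_sub] at this
  have h2 : l1 (y - (N : ℤ) • quo N y) ≤ (N : ℝ) * (d + 1) := by
    have e : y - (N : ℤ) • quo N y = repZ (Torus.proj N y) := by
      nth_rewrite 1 [eq_repZ_add_zsmul_quo (N := N) y]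
      rw [add_sub_cancel_right]
    rw [e]
    exact l1_repZ_le _
  have h3 : l1 (x' - quo N y) ≤ l1 ((N : ℤ) • (x' - quo N y)) := by
    rw [l1_natSmul]
    exact le_mul_of_one_le_left (l1_nonneg _) hN
  have h4 : l1 (x' - quo N y) ≤ l1 ((N : ℤ) • x' - y) + (N : ℝ) * (d + 1) := by linarith
  have := mul_le_mul_of_nonneg_left h4 hδ
  linarith

/-- [folklore] **UNIFORM COARSE EXPONENTIAL SUM**: `Σ'_{x′} e^{−δ|N•x′ − y|₁} ≤ e^{δN(d+1)} · Zl(δ)` for every fine site `y`. -/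
theorem tsum_exp_coarse_le (N : ℕ) [NeZero N] {δ : ℝ} (hδ : 0 < δ) (y : Site (d + 1)) :
    ∑' x' : Site (d + 1), Real.exp (-δ * l1 ((N : ℤ) • x' - y)) ≤ Real.exp (δ * ((N : ℝ) * (d + 1))) * Zl (d + 1) δ := by
  have hs := summable_exp_coarse (d := d) (Nat.one_le_iff_ne_zero.2 (NeZero.ne N)) hδ y
  have hmaj : Summable fun x' : Site (d + 1) => Real.exp (δ * ((N : ℝ) * (d + 1))) * Real.exp (-δ * l1 (x' - quo N y)) :=
    (summable_exp_shift hδ _).mul_left _ |>.congr fun x' => by rw [l1_sub_symm]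
  calc ∑' x' : Site (d + 1), Real.exp (-δ * l1 ((N : ℤ) • x' - y))
      ≤ ∑' x' : Site (d + 1), Real.exp (δ * ((N : ℝ) * (d + 1))) * Real.exp (-δ * l1 (x' - quo N y)) :=
        hs.tsum_le_tsum (fun x' => exp_coarse_le N hδ.le x' y) hmaj
    _ = Real.exp (δ * ((N : ℝ) * (d + 1))) * Zl (d + 1) δ := by
        rw [tsum_mul_left, tsum_exp_shift']

/-- [folklore] The mirrored orientation `Σ'_{z′} e^{−δ|w − N•z′|₁}`: same bound, and summable. -/
theorem tsum_exp_coarse_le' (N : ℕ) [NeZero N] {δ : ℝ} (hδ : 0 < δ) (w : Site (d + 1)) :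
    ∑' z' : Site (d + 1), Real.exp (-δ * l1 (w - (N : ℤ) • z')) ≤ Real.exp (δ * ((N : ℝ) * (d + 1))) * Zl (d + 1) δ := by
  have e : (fun z' : Site (d + 1) => Real.exp (-δ * l1 (w - (N : ℤ) • z'))) = fun z' => Real.exp (-δ * l1 ((N : ℤ) • z' - w)) :=
    funext fun z' => by rw [l1_sub_symm]
  rw [e]
  exact tsum_exp_coarse_le N hδ w

/-- [folklore] Summability in the mirrored orientation. -/
theorem summable_exp_coarse' {N : ℕ} (hN : 1 ≤ N) {δ : ℝ} (hδ : 0 < δ) (w : Site (d + 1)) :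
    Summable fun z' : Site (d + 1) => Real.exp (-δ * l1 (w - (N : ℤ) • z')) :=
  (summable_exp_coarse (d := d) hN hδ w).congr fun z' => by rw [l1_sub_symm]

/-! ## §2 The four coarse-leg charges of the packed resolvent -/

section Charges

variable {N : ℕ} [NeZero N]

/-- [folklore] **FIELD–MULTIPLIER COLUMN CHARGE**: `Σ'_{z′} KInv w (N•z′) (inl a) (inr β) = δ_{aβ} · N^{−(d+2)}` for every fine `w` ((L0∞) for `wH`). -/
theorem hasSum_KInv_inl_inr (a β : Fin (d + 1)) (w : Site (d + 1)) :
    HasSum (fun z' : Site (d + 1) => KInv (N := N) (d := d) w ((N : ℤ) • z') (Sum.inl a) (Sum.inr β))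
      (if a = β then (((N : ℕ) : ℝ) ^ (d + 1 + 1))⁻¹ else 0) := by
  have h := (constReproSum_iff_decimated (NeZero.ne N) (wH (N := N) a β) _).1 ((lowMomentsSum_specK (N := N) (d := d)).1 a β) w
  refine h.congr_fun fun z' => ?_
  rw [KInv_inl_inr_coarse]

/-- [folklore] The multiplier–multiplier entries with a coarse FIRST leg. -/
theorem KInv_inr_inr_left (α m : Fin (d + 1)) (x' y : Site (d + 1)) :
    KInv (N := N) (d := d) ((N : ℤ) • x') y (Sum.inr α) (Sum.inr m) = if Torus.proj N y = 0 then wΦ (N := N) α m (x' - quo N y) else 0 := by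
  simp only [KInv, proj_zsmul, quo_zsmul, true_and]

/-- [folklore] The multiplier–multiplier entries with a coarse SECOND leg. -/
theorem KInv_inr_inr_right (m β : Fin (d + 1)) (w z' : Site (d + 1)) :
    KInv (N := N) (d := d) w ((N : ℤ) • z') (Sum.inr m) (Sum.inr β) = if Torus.proj N w = 0 then wΦ (N := N) m β (quo N w - z') else 0 := by
  simp only [KInv, proj_zsmul, quo_zsmul, and_true]

/-- [folklore] **MULTIPLIER–MULTIPLIER ROW CHARGE ZERO** ((S2c)): `Σ'_{x′} KInv (N•x′) y (inr α) (inr m) = 0` for every fine `y`. -/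
theorem hasSum_KInv_inr_inr_left (α m : Fin (d + 1)) (y : Site (d + 1)) :
    HasSum (fun x' : Site (d + 1) => KInv (N := N) (d := d) ((N : ℤ) • x') y (Sum.inr α) (Sum.inr m)) 0 := by
  by_cases hy : Torus.proj N y = 0
  · refine (hasSum_wΦ_sub_right (N := N) α m (quo N y)).congr_fun fun x' => ?_
    rw [KInv_inr_inr_left, if_pos hy]
  · have e : (fun x' : Site (d + 1) => KInv (N := N) (d := d) ((N : ℤ) • x') y (Sum.inr α) (Sum.inr m)) = fun _ => 0 :=
      funext fun x' => by rw [KInv_inr_inr_left, if_neg hy]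
    rw [e]
    exact hasSum_zero

/-- [folklore] **MULTIPLIER–MULTIPLIER COLUMN CHARGE ZERO** ((S2c)): `Σ'_{z′} KInv w (N•z′) (inr m) (inr β) = 0` for every fine `w`. -/
theorem hasSum_KInv_inr_inr_right (m β : Fin (d + 1)) (w : Site (d + 1)) :
    HasSum (fun z' : Site (d + 1) => KInv (N := N) (d := d) w ((N : ℤ) • z') (Sum.inr m) (Sum.inr β)) 0 := by
  by_cases hw : Torus.proj N w = 0
  · refine (hasSum_wΦ_sub_left (N := N) m β (quo N w)).congr_fun fun z' => ?_
    rw [KInv_inr_inr_right, if_pos hw]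
  · have e : (fun z' : Site (d + 1) => KInv (N := N) (d := d) w ((N : ℤ) • z') (Sum.inr m) (Sum.inr β)) = fun _ => 0 :=
      funext fun z' => by rw [KInv_inr_inr_right, if_neg hw]
    rw [e]
    exact hasSum_zero

/-- [folklore] **THE ROW CHARGES OF `KInv` AGAINST `inr α`, PACKAGED ON THE FIBRE**: `−δ_{aα}·N^{−(d+2)}` on field legs, `0` on multiplier legs. -/
theorem hasSum_KInv_row (α : Fin (d + 1)) (f : Fib d) (y : Site (d + 1)) :
    HasSum (fun x' : Site (d + 1) => KInv (N := N) (d := d) ((N : ℤ) • x') y (Sum.inr α) f)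
      (Sum.elim (fun a => -(if a = α then (((N : ℕ) : ℝ) ^ (d + 1 + 1))⁻¹ else 0)) (fun _ => (0 : ℝ)) f) := by
  rcases f with a | m
  · exact hasSum_KInv_inr_inl α a y
  · exact hasSum_KInv_inr_inr_left α m y

/-- [folklore] **THE COLUMN CHARGES OF `KInv` AGAINST `inr β`, PACKAGED ON THE FIBRE**: `+δ_{bβ}·N^{−(d+2)}` on field legs, `0` on multiplier legs. -/
theorem hasSum_KInv_col (β : Fin (d + 1)) (g : Fib d) (w : Site (d + 1)) :
    HasSum (fun z' : Site (d + 1) => KInv (N := N) (d := d) w ((N : ℤ) • z') g (Sum.inr β))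
      (Sum.elim (fun b => if b = β then (((N : ℕ) : ℝ) ^ (d + 1 + 1))⁻¹ else 0) (fun _ => (0 : ℝ)) g) := by
  rcases g with b | m
  · exact hasSum_KInv_inl_inr b β w
  · exact hasSum_KInv_inr_inr_right m β w

end Charges

/-! ## §3 The sandwich read-out Fubini -/

section Sandwich

variable {N : ℕ} [NeZero N]

/-- [folklore] Product summability of the two coarse legs `(x′, z′) ↦ K (N•x′) y a f · K w (N•z′) g b` of a decaying kernel. -/
theorem summable_legs_prod {K : MKer (d + 1) (Fib d)} {C δ : ℝ} (hK : Decays K C δ) (hδ : 0 < δ) (y w : Site (d + 1))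
    (a b f g : Fib d) :
    Summable fun xz : Site (d + 1) × Site (d + 1) => K ((N : ℤ) • xz.1) y a f * K w ((N : ℤ) • xz.2) g b := by
  have hN : 1 ≤ N := Nat.one_le_iff_ne_zero.2 (NeZero.ne N)
  have hC : 0 ≤ C := hK.nonneg a
  have h1 := summable_exp_coarse (d := d) hN hδ y
  have h2 := summable_exp_coarse' (d := d) hN hδ w
  have hprod := ((h1.mul_of_nonneg h2 (fun _ => (Real.exp_pos _).le) (fun _ => (Real.exp_pos _).le)).mul_left (C * C))
  refine Summable.of_norm_bounded hprod (fun xz => ?_)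
  rw [Real.norm_eq_abs, abs_mul]
  have e1 := hK ((N : ℤ) • xz.1) y a f
  have e2 := hK w ((N : ℤ) • xz.2) g b
  calc |K ((N : ℤ) • xz.1) y a f| * |K w ((N : ℤ) • xz.2) g b|
      ≤ (C * Real.exp (-δ * l1 ((N : ℤ) • xz.1 - y))) * (C * Real.exp (-δ * l1 (w - (N : ℤ) • xz.2))) :=
        mul_le_mul e1 e2 (abs_nonneg _) ((abs_nonneg _).trans e1)
    _ = _ := by ring

/-- [folklore] **THE SANDWICH READ-OUT FUBINI.**  Let `K` decay (rate `δ > 0`) and have SITE-FREE coarse-leg charges against the multiplier legs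
`inr α` (rows, `ρL f`) and `inr β` (columns, `ρR g`); let `V` be bi-localised.  Then the `mm`-entries of `K ∘ V ∘ K` read at the coarse points
have the double-leg `HasSum` `Σ'_{(y,w)} Σ_{f,g} ρL f · V y w f g · ρR g`. -/
theorem hasSum_sandwich_readout {K V : MKer (d + 1) (Fib d)} {C δ Cv δv : ℝ} {p q : Site (d + 1)} (hK : Decays K C δ) (hδ : 0 < δ)
    (hV : BiLoc V p q Cv δv) (hδv : 0 < δv) (α β : Fin (d + 1)) {ρL ρR : Fib d → ℝ}
    (hrow : ∀ f y, HasSum (fun x' : Site (d + 1) => K ((N : ℤ) • x') y (Sum.inr α) f) (ρL f))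
    (hcol : ∀ g w, HasSum (fun z' : Site (d + 1) => K w ((N : ℤ) • z') g (Sum.inr β)) (ρR g)) :
    HasSum (fun xz : Site (d + 1) × Site (d + 1) => comp (comp K V) K ((N : ℤ) • xz.1) ((N : ℤ) • xz.2) (Sum.inr α) (Sum.inr β))
      (∑' yw : Site (d + 1) × Site (d + 1), ∑ f, ∑ g, ρL f * V yw.1 yw.2 f g * ρR g) := by
  classical
  have hN : 1 ≤ N := Nat.one_le_iff_ne_zero.2 (NeZero.ne N)
  have hC : 0 ≤ C := hK.nonneg (Sum.inl 0)
  have hCv : 0 ≤ Cv := hV.nonneg (Sum.inl 0)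
  set cF : ℝ := ((Fintype.card (Fib d) : ℕ) : ℝ) with hcF
  -- the four-leg family, outer index `(y, w)`, inner index `(x′, z′)`
  set Φ : Site (d + 1) × Site (d + 1) → Site (d + 1) × Site (d + 1) → ℝ := fun yw xz =>
    ∑ f, ∑ g, K ((N : ℤ) • xz.1) yw.1 (Sum.inr α) f * V yw.1 yw.2 f g * K yw.2 ((N : ℤ) • xz.2) g (Sum.inr β) with hΦ
  -- the majorant and its sums
  set U : ℝ := Real.exp (δ * ((N : ℝ) * (d + 1))) * Zl (d + 1) δ with hU
  set M : Site (d + 1) × Site (d + 1) → Site (d + 1) × Site (d + 1) → ℝ := fun yw xz =>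
    (cF * cF * (C * Cv * C) * Real.exp (-δv * (l1 (yw.1 - p) + l1 (yw.2 - q)))) *
      (Real.exp (-δ * l1 ((N : ℤ) • xz.1 - yw.1)) * Real.exp (-δ * l1 (yw.2 - (N : ℤ) • xz.2))) with hM
  have hM0 : ∀ yw xz, 0 ≤ M yw xz := fun yw xz => by positivity
  have hΦM : ∀ yw xz, |Φ yw xz| ≤ M yw xz := by
    intro yw xz
    have hterm : ∀ f g, |K ((N : ℤ) • xz.1) yw.1 (Sum.inr α) f * V yw.1 yw.2 f g * K yw.2 ((N : ℤ) • xz.2) g (Sum.inr β)| ≤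
        (C * Real.exp (-δ * l1 ((N : ℤ) • xz.1 - yw.1))) * (Cv * Real.exp (-δv * (l1 (yw.1 - p) + l1 (yw.2 - q)))) *
          (C * Real.exp (-δ * l1 (yw.2 - (N : ℤ) • xz.2))) := by
      intro f g
      rw [abs_mul, abs_mul]
      have e1 := hK ((N : ℤ) • xz.1) yw.1 (Sum.inr α) f
      have e2 := hV yw.1 yw.2 f g
      have e3 := hK yw.2 ((N : ℤ) • xz.2) g (Sum.inr β)
      exact mul_le_mul (mul_le_mul e1 e2 (abs_nonneg _) ((abs_nonneg _).trans e1)) e3 (abs_nonneg _)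
        (mul_nonneg ((abs_nonneg _).trans e1) ((abs_nonneg _).trans e2))
    calc |Φ yw xz| ≤ ∑ f, ∑ g, |K ((N : ℤ) • xz.1) yw.1 (Sum.inr α) f * V yw.1 yw.2 f g * K yw.2 ((N : ℤ) • xz.2) g (Sum.inr β)| :=
          (Finset.abs_sum_le_sum_abs _ _).trans (Finset.sum_le_sum fun f _ => Finset.abs_sum_le_sum_abs _ _)
      _ ≤ ∑ _f : Fib d, ∑ _g : Fib d, (C * Real.exp (-δ * l1 ((N : ℤ) • xz.1 - yw.1))) *
            (Cv * Real.exp (-δv * (l1 (yw.1 - p) + l1 (yw.2 - q)))) * (C * Real.exp (-δ * l1 (yw.2 - (N : ℤ) • xz.2))) :=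
          Finset.sum_le_sum fun f _ => Finset.sum_le_sum fun g _ => hterm f g
      _ = M yw xz := by
          simp only [Finset.sum_const, Finset.card_univ, nsmul_eq_mul, hM, hcF]
          ring
  -- inner sums of the majorant
  have hMin : ∀ yw, HasSum (fun xz => M yw xz)
      ((cF * cF * (C * Cv * C) * Real.exp (-δv * (l1 (yw.1 - p) + l1 (yw.2 - q)))) *
        ((∑' x' : Site (d + 1), Real.exp (-δ * l1 ((N : ℤ) • x' - yw.1))) *
          ∑' z' : Site (d + 1), Real.exp (-δ * l1 (yw.2 - (N : ℤ) • z')))) := by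
    intro yw
    have h1 := summable_exp_coarse (d := d) hN hδ yw.1
    have h2 := summable_exp_coarse' (d := d) hN hδ yw.2
    have h12 := h1.hasSum.mul h2.hasSum (h1.mul_of_nonneg h2 (fun _ => (Real.exp_pos _).le) (fun _ => (Real.exp_pos _).le))
    exact h12.mul_left _
  have hMs : Summable (Function.uncurry M) := by
    refine (summable_prod_of_nonneg (fun s => hM0 s.1 s.2)).2 ⟨fun yw => (hMin yw).summable, ?_⟩
    have hbound : ∀ yw : Site (d + 1) × Site (d + 1), ∑' xz, M yw xz ≤
        (cF * cF * (C * Cv * C) * (U * U)) * (Real.exp (-δv * l1 (yw.1 - p)) * Real.exp (-δv * l1 (yw.2 - q))) := by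
      intro yw
      rw [(hMin yw).tsum_eq, mul_add, Real.exp_add]
      have hA := tsum_exp_coarse_le (d := d) N hδ yw.1
      have hB := tsum_exp_coarse_le' (d := d) N hδ yw.2
      have hA0 : 0 ≤ ∑' x' : Site (d + 1), Real.exp (-δ * l1 ((N : ℤ) • x' - yw.1)) := tsum_nonneg fun _ => (Real.exp_pos _).le
      have hB0 : 0 ≤ ∑' z' : Site (d + 1), Real.exp (-δ * l1 (yw.2 - (N : ℤ) • z')) := tsum_nonneg fun _ => (Real.exp_pos _).le
      have hU0 : 0 ≤ U := mul_nonneg (Real.exp_pos _).le (Zl_nonneg hδ)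
      have hAB := mul_le_mul hA hB hB0 hU0
      have hc0 : 0 ≤ cF * cF * (C * Cv * C) * (Real.exp (-δv * l1 (yw.1 - p)) * Real.exp (-δv * l1 (yw.2 - q))) := by positivity
      calc cF * cF * (C * Cv * C) * (Real.exp (-δv * l1 (yw.1 - p)) * Real.exp (-δv * l1 (yw.2 - q))) *
            ((∑' x' : Site (d + 1), Real.exp (-δ * l1 ((N : ℤ) • x' - yw.1))) * ∑' z' : Site (d + 1), Real.exp (-δ * l1 (yw.2 - (N : ℤ) • z')))
          ≤ cF * cF * (C * Cv * C) * (Real.exp (-δv * l1 (yw.1 - p)) * Real.exp (-δv * l1 (yw.2 - q))) * (U * U) :=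
            mul_le_mul_of_nonneg_left hAB hc0
        _ = _ := by ring
    have hsum : Summable fun yw : Site (d + 1) × Site (d + 1) =>
        (cF * cF * (C * Cv * C) * (U * U)) * (Real.exp (-δv * l1 (yw.1 - p)) * Real.exp (-δv * l1 (yw.2 - q))) :=
      ((summable_exp_shift' hδv p).mul_of_nonneg (summable_exp_shift' hδv q) (fun _ => (Real.exp_pos _).le)
        (fun _ => (Real.exp_pos _).le)).mul_left _
    exact Summable.of_nonneg_of_le (fun yw => tsum_nonneg fun xz => hM0 yw xz) hbound hsum
  -- (A) absolute summability of the four-leg family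
  have hΦs : Summable (Function.uncurry Φ) :=
    Summable.of_norm_bounded hMs (fun s => by rw [Real.norm_eq_abs]; exact hΦM s.1 s.2)
  -- (C) the inner sums: only the charges survive
  have hΦin : ∀ yw : Site (d + 1) × Site (d + 1), HasSum (fun xz => Φ yw xz) (∑ f, ∑ g, ρL f * V yw.1 yw.2 f g * ρR g) := by
    intro yw
    refine hasSum_sum fun f _ => hasSum_sum fun g _ => ?_
    have hmul := ((hrow f yw.1).mul (hcol g yw.2) (summable_legs_prod hK hδ yw.1 yw.2 _ _ f g)).mul_left (V yw.1 yw.2 f g)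
    rw [show V yw.1 yw.2 f g * (ρL f * ρR g) = ρL f * V yw.1 yw.2 f g * ρR g by ring] at hmul
    exact hmul.congr_fun fun xz => by ring
  -- (B) the pointwise identity: the nested composition IS the `(y, w)`-sum of `Φ`
  have hΦyw : ∀ xz : Site (d + 1) × Site (d + 1), Summable fun yw : Site (d + 1) × Site (d + 1) => Φ yw xz :=
    fun xz => hΦs.prod_symm.prod_factor xz
  have hpoint : ∀ xz : Site (d + 1) × Site (d + 1),
      comp (comp K V) K ((N : ℤ) • xz.1) ((N : ℤ) • xz.2) (Sum.inr α) (Sum.inr β) = ∑' yw : Site (d + 1) × Site (d + 1), Φ yw xz := by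
    intro xz
    -- summability of the `(w, y)`-ordered family and of its `y`-slices with one fibre index fixed
    have hwy : Summable fun wy : Site (d + 1) × Site (d + 1) => Φ (wy.2, wy.1) xz :=
      (Equiv.prodComm (Site (d + 1)) (Site (d + 1))).summable_iff.2 (hΦyw xz) |>.congr fun wy => rfl
    have hslice : ∀ (w : Site (d + 1)) (g : Fib d), Summable fun y : Site (d + 1) =>
        ∑ f, K ((N : ℤ) • xz.1) y (Sum.inr α) f * V y w f g * K w ((N : ℤ) • xz.2) g (Sum.inr β) := by
      intro w g
      have hmaj : Summable fun y : Site (d + 1) => (cF * (C * Cv * (C * Real.exp (-δ * l1 (w - (N : ℤ) • xz.2))))) *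
          Real.exp (-δ * l1 ((N : ℤ) • xz.1 - y)) := (summable_exp_shift hδ _).mul_left _
      refine Summable.of_norm_bounded hmaj (fun y => ?_)
      rw [Real.norm_eq_abs]
      have hterm : ∀ f, |K ((N : ℤ) • xz.1) y (Sum.inr α) f * V y w f g * K w ((N : ℤ) • xz.2) g (Sum.inr β)| ≤
          (C * Real.exp (-δ * l1 ((N : ℤ) • xz.1 - y))) * Cv * (C * Real.exp (-δ * l1 (w - (N : ℤ) • xz.2))) := by
        intro f
        rw [abs_mul, abs_mul]
        have e1 := hK ((N : ℤ) • xz.1) y (Sum.inr α) f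
        have e2 : |V y w f g| ≤ Cv := by
          refine (hV y w f g).trans ?_
          have : Real.exp (-δv * (l1 (y - p) + l1 (w - q))) ≤ 1 :=
            Real.exp_le_one_iff.2 (by nlinarith [l1_nonneg (y - p), l1_nonneg (w - q)])
          nlinarith
        have e3 := hK w ((N : ℤ) • xz.2) g (Sum.inr β)
        exact mul_le_mul (mul_le_mul e1 e2 (abs_nonneg _) ((abs_nonneg _).trans e1)) e3 (abs_nonneg _)
          (mul_nonneg ((abs_nonneg _).trans e1) ((abs_nonneg _).trans e2))
      calc |∑ f, K ((N : ℤ) • xz.1) y (Sum.inr α) f * V y w f g * K w ((N : ℤ) • xz.2) g (Sum.inr β)|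
          ≤ ∑ f, |K ((N : ℤ) • xz.1) y (Sum.inr α) f * V y w f g * K w ((N : ℤ) • xz.2) g (Sum.inr β)| := Finset.abs_sum_le_sum_abs _ _
        _ ≤ ∑ _f : Fib d, (C * Real.exp (-δ * l1 ((N : ℤ) • xz.1 - y))) * Cv * (C * Real.exp (-δ * l1 (w - (N : ℤ) • xz.2))) :=
            Finset.sum_le_sum fun f _ => hterm f
        _ = _ := by simp only [Finset.sum_const, Finset.card_univ, nsmul_eq_mul, hcF]; ring
    -- rewrite the nested composition
    have hinner : ∀ w : Site (d + 1), ∑ g, comp K V ((N : ℤ) • xz.1) w (Sum.inr α) g * K w ((N : ℤ) • xz.2) g (Sum.inr β)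
        = ∑' y : Site (d + 1), Φ (y, w) xz := by
      intro w
      have e1 : ∀ g, comp K V ((N : ℤ) • xz.1) w (Sum.inr α) g * K w ((N : ℤ) • xz.2) g (Sum.inr β)
          = ∑' y : Site (d + 1), ∑ f, K ((N : ℤ) • xz.1) y (Sum.inr α) f * V y w f g * K w ((N : ℤ) • xz.2) g (Sum.inr β) := by
        intro g
        simp only [comp]
        rw [← tsum_mul_right]
        exact tsum_congr fun y => by rw [Finset.sum_mul]
      simp_rw [e1]
      rw [(Summable.tsum_finsetSum fun g _ => hslice w g).symm]
      exact tsum_congr fun y => Finset.sum_comm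
    calc comp (comp K V) K ((N : ℤ) • xz.1) ((N : ℤ) • xz.2) (Sum.inr α) (Sum.inr β)
        = ∑' w : Site (d + 1), ∑' y : Site (d + 1), Φ (y, w) xz := by
          simp only [comp] at hinner ⊢
          exact tsum_congr fun w => hinner w
      _ = ∑' wy : Site (d + 1) × Site (d + 1), Φ (wy.2, wy.1) xz := (hwy.tsum_prod).symm
      _ = ∑' yw : Site (d + 1) × Site (d + 1), Φ yw xz :=
          (Equiv.prodComm (Site (d + 1)) (Site (d + 1))).tsum_eq (fun yw : Site (d + 1) × Site (d + 1) => Φ yw xz)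
  -- (D) assemble
  have hF : Summable fun xz : Site (d + 1) × Site (d + 1) => ∑' yw : Site (d + 1) × Site (d + 1), Φ yw xz := hΦs.prod_symm.prod
  have hval : ∑' xz : Site (d + 1) × Site (d + 1), ∑' yw : Site (d + 1) × Site (d + 1), Φ yw xz
      = ∑' yw : Site (d + 1) × Site (d + 1), ∑ f, ∑ g, ρL f * V yw.1 yw.2 f g * ρR g := by
    rw [hΦs.tsum_comm]
    exact tsum_congr fun yw => (hΦin yw).tsum_eq
  have h := hF.hasSum
  rw [hval] at h
  exact h.congr_fun fun xz => hpoint xz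

/-- [folklore] **THE SANDWICH READ-OUT OF THE PACKED RESOLVENT**: for `K = KInv N` and any bi-localised `V`,
`Σ'_{(x′,z′)} (KInv ∘ V ∘ KInv)(N•x′, N•z′)_{(inr α, inr β)} = −N^{−2(d+2)} · Σ'_{(y,w)} V y w (inl α) (inl β)` — ONLY the field–field double-leg
sum of `V` survives ((Q-lin) on both field legs, (S2c) on both multiplier legs). -/
theorem hasSum_sandwich_readout_KInv {V : MKer (d + 1) (Fib d)} {Cv δv : ℝ} {p q : Site (d + 1)} (hV : BiLoc V p q Cv δv) (hδv : 0 < δv)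
    (α β : Fin (d + 1)) :
    HasSum (fun xz : Site (d + 1) × Site (d + 1) =>
        comp (comp (KInv (N := N) (d := d)) V) (KInv (N := N) (d := d)) ((N : ℤ) • xz.1) ((N : ℤ) • xz.2) (Sum.inr α) (Sum.inr β))
      (-((((N : ℕ) : ℝ) ^ (d + 1 + 1))⁻¹ * (((N : ℕ) : ℝ) ^ (d + 1 + 1))⁻¹) *
        ∑' yw : Site (d + 1) × Site (d + 1), V yw.1 yw.2 (Sum.inl α) (Sum.inl β)) := by
  obtain ⟨δ, C, hδ, hC, hK⟩ := decays_KInv (N := N) (d := d)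
  set σ : ℝ := (((N : ℕ) : ℝ) ^ (d + 1 + 1))⁻¹ with hσ
  have h := hasSum_sandwich_readout (N := N) hK hδ hV hδv α β (fun f y => hasSum_KInv_row α f y) (fun g w => hasSum_KInv_col β g w)
  have hfin : ∀ yw : Site (d + 1) × Site (d + 1),
      ∑ f, ∑ g, Sum.elim (fun a => -(if a = α then σ else 0)) (fun _ => (0 : ℝ)) f * V yw.1 yw.2 f g *
          Sum.elim (fun b => if b = β then σ else 0) (fun _ => (0 : ℝ)) g
        = -(σ * σ) * V yw.1 yw.2 (Sum.inl α) (Sum.inl β) := by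
    intro yw
    rw [Fintype.sum_sum_type]
    have hr : ∑ m : Fin (d + 1), ∑ g, Sum.elim (fun a => -(if a = α then σ else 0)) (fun _ => (0 : ℝ)) (Sum.inr m : Fib d) * V yw.1 yw.2 (Sum.inr m) g *
        Sum.elim (fun b => if b = β then σ else 0) (fun _ => (0 : ℝ)) g = 0 :=
      Finset.sum_eq_zero fun m _ => Finset.sum_eq_zero fun g _ => by simp only [Sum.elim_inr, zero_mul]
    rw [hr, add_zero]
    have hl : ∀ a : Fin (d + 1), ∑ g, Sum.elim (fun a => -(if a = α then σ else 0)) (fun _ => (0 : ℝ)) (Sum.inl a : Fib d) * V yw.1 yw.2 (Sum.inl a) g *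
        Sum.elim (fun b => if b = β then σ else 0) (fun _ => (0 : ℝ)) g
        = -(if a = α then σ else 0) * V yw.1 yw.2 (Sum.inl a) (Sum.inl β) * σ := by
      intro a
      rw [Fintype.sum_sum_type]
      have h2 : ∑ m : Fin (d + 1), Sum.elim (fun a => -(if a = α then σ else 0)) (fun _ => (0 : ℝ)) (Sum.inl a : Fib d) * V yw.1 yw.2 (Sum.inl a) (Sum.inr m) *
          Sum.elim (fun b => if b = β then σ else 0) (fun _ => (0 : ℝ)) (Sum.inr m : Fib d) = 0 :=
        Finset.sum_eq_zero fun m _ => by simp only [Sum.elim_inr, mul_zero]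
      rw [h2, add_zero, Finset.sum_eq_single β]
      · show -(if a = α then σ else 0) * V yw.1 yw.2 (Sum.inl a) (Sum.inl β) * (if β = β then σ else 0) = _
        rw [if_pos rfl]
      · intro b _ hb
        simp only [Sum.elim_inl, if_neg hb, mul_zero]
      · intro hβ
        exact absurd (Finset.mem_univ β) hβ
    simp_rw [hl]
    rw [Finset.sum_eq_single α]
    · rw [if_pos rfl]
      ring
    · intro a _ ha
      rw [if_neg ha, neg_zero, zero_mul, zero_mul]
    · intro hα
      exact absurd (Finset.mem_univ α) hα
  rw [← hσ] at h
  simp_rw [hfin] at h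
  rw [tsum_mul_left] at h
  exact h

end Sandwich

end Summit.QuantumFields.BalabanUV.Beta.GAN24.ResolventLegCharges

end
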